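import Mathlib

/-!
# The half-index dictionary: `Λ₁ ⊆ n·Λ₀  ⟺  Λ₀/Λ₁ ↠ (ℤ/n)^{rank}`

Blind cell `pub-manin-gamma0`, seat p3 (generation 2).  README §1.0 defines the HALF-INDEX configuration as `Λ₁(f) ⊆ 2·Λ₀(f)` and says
«equivalently: `Λ₀(f)/Λ₁(f)` surjects onto `(ℤ/2)²`»; `proofs/ManinCorollary_p3.md` step (3) uses the same dictionary for every prime
(`C = Λ₀/Λ₁` non-cyclic ⟺ some prime `p` with `Λ₁ ⊆ pΛ₀`).  For a free `ℤ`-module `M` (the lattice `Λ₀`) with a finite basis indexed by `ι`,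
an integer `n ≥ 1`, and a subgroup `L` (the lattice `Λ₁`) we prove:

* `exists_surjective_of_forall_eq_smul`: if every element of `L` is `n` times an element of `M`, the coordinate map `M → (ι → ℤ/n)` is a
  surjective homomorphism killing `L`;
* `forall_eq_smul_of_surjective`: conversely, if SOME surjective homomorphism `M → (ι → ℤ/n)` kills `L`, then `L ⊆ n·M`
  (counting argument: the induced endomorphism of the finite group `(ℤ/n)^ι` is surjective, hence injective);
* `halfIndex_iff`: the equivalence.
With `ι = Fin 2`, `n = 2` this is exactly the brief's «equivalently».  Only Mathlib is imported; no definitions are introduced.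
-/

namespace ManinGamma
namespace HalfIndex

open Module

/-- The coordinate reduction map is a surjection `M → (ι → ℤ/n)` killing `n·M` (and hence any `L ⊆ n·M`). -/
theorem exists_surjective_of_forall_eq_smul {M : Type*} [AddCommGroup M] {ι : Type*} [Fintype ι] [DecidableEq ι]
    (b : Basis ι ℤ M) (n : ℕ) [NeZero n] (L : AddSubgroup M) (hL : ∀ x ∈ L, ∃ y : M, x = (n : ℤ) • y) :
    ∃ f : M →+ (ι → ZMod n), Function.Surjective f ∧ ∀ x ∈ L, f x = 0 := by
  let f : M →+ (ι → ZMod n) :=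
    { toFun := fun m i => ((b.repr m i : ℤ) : ZMod n)
      map_zero' := by ext i; simp
      map_add' := by intro x y; ext i; simp }
  refine ⟨f, ?_, ?_⟩
  · intro t
    refine ⟨b.equivFun.symm (fun i => ((t i).val : ℤ)), ?_⟩
    ext i
    show ((b.repr (b.equivFun.symm fun i => ((t i).val : ℤ)) i : ℤ) : ZMod n) = t i
    rw [← Basis.equivFun_apply, LinearEquiv.apply_symm_apply]
    simp
  · intro x hx
    obtain ⟨y, hy⟩ := hL x hx
    ext i
    show ((b.repr x i : ℤ) : ZMod n) = 0
    rw [hy, map_smul, Finsupp.smul_apply, smul_eq_mul]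
    push_cast
    simp

/-- The counting direction: a surjection `M → (ι → ℤ/n)` that kills `x` forces `x ∈ n·M`. -/
theorem eq_smul_of_surjective {M : Type*} [AddCommGroup M] {ι : Type*} [Fintype ι] [DecidableEq ι]
    (b : Basis ι ℤ M) (n : ℕ) [NeZero n] (f : M →+ (ι → ZMod n)) (hf : Function.Surjective f)
    (x : M) (hx : f x = 0) : ∃ y : M, x = (n : ℤ) • y := by
  -- the induced endomorphism ψ of (ℤ/n)^ι
  let e : ι → (ι → ZMod n) := fun i => f (b i)
  let ψ : (ι → ZMod n) →+ (ι → ZMod n) :=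
    { toFun := fun u => ∑ i, u i • e i
      map_zero' := by simp
      map_add' := by intro u v; simp [add_smul, Finset.sum_add_distrib] }
  -- f factors through ψ via coordinates mod n
  have hfac : ∀ m : M, f m = ψ (fun i => ((b.repr m i : ℤ) : ZMod n)) := by
    intro m
    conv_lhs => rw [← b.sum_repr m]
    rw [map_sum]
    show ∑ i, f (b.repr m i • b i) = ∑ i, ((b.repr m i : ℤ) : ZMod n) • e i
    refine Finset.sum_congr rfl (fun i _ => ?_)
    rw [map_zsmul, Int.cast_smul_eq_zsmul]
  have hψsurj : Function.Surjective ψ := by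
    intro t
    obtain ⟨m, hm⟩ := hf t
    exact ⟨_, by rw [← hfac m, hm]⟩
  have hψinj : Function.Injective ψ := Finite.injective_iff_surjective.mpr hψsurj
  -- the coordinates of x vanish mod n
  have hcoord : ∀ i, ((b.repr x i : ℤ) : ZMod n) = 0 := by
    have h0 : ψ (fun i => ((b.repr x i : ℤ) : ZMod n)) = ψ 0 := by rw [← hfac x, hx, map_zero]
    have := hψinj h0
    intro i
    exact congrFun this i
  choose w hw using fun i => (ZMod.intCast_zmod_eq_zero_iff_dvd (b.repr x i) n).mp (hcoord i)
  refine ⟨∑ i, w i • b i, ?_⟩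
  conv_lhs => rw [← b.sum_repr x]
  rw [Finset.smul_sum]
  refine Finset.sum_congr rfl (fun i _ => ?_)
  rw [hw i, smul_smul]

/-- Same, for a subgroup: a surjection `M → (ι → ℤ/n)` killing `L` forces `L ⊆ n·M`. -/
theorem forall_eq_smul_of_surjective {M : Type*} [AddCommGroup M] {ι : Type*} [Fintype ι] [DecidableEq ι]
    (b : Basis ι ℤ M) (n : ℕ) [NeZero n] (L : AddSubgroup M) (f : M →+ (ι → ZMod n)) (hf : Function.Surjective f)
    (hL : ∀ x ∈ L, f x = 0) : ∀ x ∈ L, ∃ y : M, x = (n : ℤ) • y :=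
  fun x hx => eq_smul_of_surjective b n f hf x (hL x hx)

/-- **The dictionary.**  For a free `ℤ`-module `M` with finite basis `ι`, `n ≥ 1`, and a subgroup `L`:
`L ⊆ n·M` iff some surjective homomorphism `M → (ℤ/n)^ι` kills `L` (i.e. `M/L ↠ (ℤ/n)^ι`). -/
theorem halfIndex_iff {M : Type*} [AddCommGroup M] {ι : Type*} [Fintype ι] [DecidableEq ι]
    (b : Basis ι ℤ M) (n : ℕ) [NeZero n] (L : AddSubgroup M) :
    (∀ x ∈ L, ∃ y : M, x = (n : ℤ) • y) ↔ ∃ f : M →+ (ι → ZMod n), Function.Surjective f ∧ ∀ x ∈ L, f x = 0 :=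
  ⟨exists_surjective_of_forall_eq_smul b n L,
    fun ⟨f, hf, hL⟩ => forall_eq_smul_of_surjective b n L f hf hL⟩

end HalfIndex
end ManinGamma
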